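import Literature.NumberTheory.IwasawaTheory.NarrowFukudaCertificateLayerModels
import Literature.NumberTheory.NumberFields.QuadraticExtensionEvenNarrowClassNumber
import Literature.NumberTheory.EllipticCurves.ZpExtensionRestrictCyclotomic
import HarnessLib

/-!
# The narrow `2`-rank JUMPS between the layers `0` and `1` of the cyclotomic `ℤ₂`-extension of a totally real field of odd degree with odd narrow
# class number and two primes ramified in `K(√2)` — the rung `n = 0` of the narrow rank certificate is then impossible (proved; no definition, no named fact)

Topic `NumberTheory/IwasawaTheory`; namespace `Literature.NumberTheory.IwasawaTheory` (that of `NarrowFukudaCertificateLayerModels.lean`). THEOREM-ONLY file,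
written by the prover seat `bsd-2adic-k4-w2` GEN 12 (cell `bsd-2adic`; `--supports` stmt-BirchSwinnertonDyer-22617). The layer currency of the narrow parity
ascent `AmbiguousClass.even_narrowClassNumber_of_quadratic_of_isTotallyReal_of_odd_narrowClassNumber` (`QuadraticExtensionEvenNarrowClassNumber.lean`, this
seat): for `K` totally real of odd degree with `h⁺(K)` odd, `κ` a cyclotomic `ℤ₂`-extension, and a model `L ⊇ K` of `K_1 = K(√2)` (`[L:K] = 2`, `θ² = 2`, Galois,
totally real) in which at least two finite primes of `K` ramify (`4 ∣ ∏_𝔭 e_𝔭(L/K)`):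

  `[Cl⁺(K_1) : Cl⁺(K_1)²]` is EVEN while `[Cl⁺(K_0) : Cl⁺(K_0)²] = 1` — the narrow `2`-rank jumps from `0` to `≥ 1` between the layers `0` and `1`.

Hence the layer-`0/1` rung of the narrow rank certificate (Fukuda's Theorem 1 (2) read at `n₀ = n = 0`: `rank₂ Cl⁺(K_1) = rank₂ Cl⁺(K_0)`, tree
`NarrowFukuda.narrowMu_of_layerOne_model`, Summit doors `conjA_two_cubicModel_of_narrowRank_sqrtTwo_model` / `conjA_two_<L>_of_narrowRankEq₀₁`) can hold on NO
such field: the first rung that can hold is `n = 1`.  This is the situation of the totally real cubic point fields `ℚ(P)` of K4's additive `Δ > 0` census rows with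
`h⁺(ℚ(P)) = 1` and two primes above `2` (`261648q1`, `279440c1`, `293200be1`, `412992bw1`, `467928d1`; seat census of 2026-08-29, two engines).

* `index_range_pow_narrowClassGroup_eq_one_of_odd_narrowClassNumber` — `h⁺(F)` odd ⟹ `[Cl⁺(F) : Cl⁺(F)²] = 1` (squaring is onto a group of odd order).
* ★ `index_range_pow_two_narrowClassGroup_layer_one_ne_layer_zero` — the displayed inequality for every cyclotomic `κ` and any `NumberField` instances on
  the layers.
* `not_forall_index_range_pow_two_narrowClassGroup_layer_one_eq_layer_zero` — the NEGATION of the layer-`0/1` certificate hypothesis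
  «for every cyclotomic `κ`, `[Cl⁺(K_1) : (Cl⁺)²] = [Cl⁺(K_0) : (Cl⁺)²]`» (a cyclotomic `ℤ₂`-extension of `K` exists as `[K:ℚ]` is odd).

References: [Fukuda1994] Thm. 1 (2), p. 264; [Gras2003] IV.4 (narrow genus theory); [Washington1997] §13.1 (`K_1 = K(√2)`); [FrohlichTaylor1990] Ch. V §1 (1.12).
-/

noncomputable section

open scoped NumberField
open NumberField Field IsDedekindDomain

namespace Literature.NumberTheory.IwasawaTheory

open Literature.NumberTheory.EllipticCurves Literature.NumberTheory.NumberFields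
  Literature.NumberTheory.NumberFields.AmbiguousClass

variable {K : Type} [Field K] [NumberField K]

omit [NumberField K] in
/-- **`h⁺(F)` odd ⟹ `[Cl⁺(F) : Cl⁺(F)²] = 1`**: squaring is a bijection of a finite group of odd order (`powCoprime`), so `Cl⁺(F)² = Cl⁺(F)`.
[cite: FrohlichTaylor1990, Ch. V §1 (1.12)–(1.13), p. 164] [cite: Washington1997, §13.3 (p-ranks)] -/
theorem index_range_pow_narrowClassGroup_eq_one_of_odd_narrowClassNumber [NumberField K] (hodd : Odd (narrowClassNumber K)) :
    (powMonoidHom (α := NarrowClassGroup K) 2).range.index = 1 := by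
  rw [Subgroup.index_eq_one, MonoidHom.range_eq_top]
  have hcop : (Nat.card (NarrowClassGroup K)).Coprime 2 := by
    change (narrowClassNumber K).Coprime 2
    exact Nat.Coprime.symm (Nat.coprime_two_left.mpr hodd)
  intro g
  exact ⟨(powCoprime hcop).symm g, (powCoprime hcop).apply_symm_apply g⟩

/-- ★ **The narrow `2`-rank jumps between the layers `0` and `1`.**  `K` totally real of odd degree with `h⁺(K)` odd, `κ` a cyclotomic `ℤ₂`-extension of `K`,
`L ⊇ K` Galois of degree `2`, totally real, containing a square root `θ` of `2` (a model of `K_1 = K(√2)`), with `4 ∣ ∏_𝔭 e_𝔭(L/K)` (at least two finite primes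
of `K` ramify in `L`) ⟹ `[Cl⁺(K_1) : Cl⁺(K_1)²] ≠ [Cl⁺(K_0) : Cl⁺(K_0)²]` (left side even, right side `1`), for any `NumberField` instances on the layers.
[cite: Fukuda1994, Thm. 1 (2), p. 264] [cite: Gras2003, IV.4] [cite: Washington1997, §13.1] -/
theorem index_range_pow_two_narrowClassGroup_layer_one_ne_layer_zero [IsTotallyReal K] (hdeg : Odd (Module.finrank ℚ K))
    (κ : ZpExtension K 2) (hκ : κ.IsCyclotomic)
    (L : Type) [Field L] [NumberField L] [Algebra K L] [IsGalois K L] [IsTotallyReal L] (hL : Module.finrank K L = 2)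
    (θ : L) (hθ : θ ^ 2 = 2) (hram : 4 ∣ ∏ᶠ v : HeightOneSpectrum (𝓞 K), v.asIdeal.ramificationIdxIn (𝓞 L))
    (hK : Odd (narrowClassNumber K)) [NumberField (κ.layer 0)] [NumberField (κ.layer 1)] :
    (powMonoidHom (α := NarrowClassGroup (κ.layer 1)) 2).range.index ≠ (powMonoidHom (α := NarrowClassGroup (κ.layer 0)) 2).range.index := by
  haveI : Fact (Nat.Prime 2) := ⟨Nat.prime_two⟩
  rw [index_range_pow_narrowClassGroup_layer_one_eq hdeg κ hκ L hL θ hθ 2, index_range_pow_narrowClassGroup_layer_zero_eq κ 2,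
    index_range_pow_narrowClassGroup_eq_one_of_odd_narrowClassNumber hK]
  intro h1
  have h2 := two_dvd_index_range_pow_two_narrowClassGroup_of_quadratic (K := K) (L := L) hL hram hK
  rw [h1] at h2
  exact absurd h2 (by norm_num)

/-- **The layer-`0/1` narrow rank certificate is IMPOSSIBLE** under the hypotheses of `index_range_pow_two_narrowClassGroup_layer_one_ne_layer_zero`: it is NOT the
case that `[Cl⁺(K_1) : Cl⁺(K_1)²] = [Cl⁺(K_0) : Cl⁺(K_0)²]` for every cyclotomic `ℤ₂`-extension of `K` (with all `NumberField` instances on the layers) — a cyclotomic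
`ℤ₂`-extension of the odd-degree field `K` exists (restriction of `ℚ_∞`).  The negation of the displayed hypothesis `hnr` of the census instances
`conjA_two_<L>_of_narrowRankEq₀₁`. [cite: Fukuda1994, Thm. 1 (2), p. 264] [cite: Gras2003, IV.4] [cite: Washington1997, §13.1 and Prop. 13.2] -/
theorem not_forall_index_range_pow_two_narrowClassGroup_layer_one_eq_layer_zero [IsTotallyReal K] (hdeg : Odd (Module.finrank ℚ K))
    (L : Type) [Field L] [NumberField L] [Algebra K L] [IsGalois K L] [IsTotallyReal L] (hL : Module.finrank K L = 2)
    (θ : L) (hθ : θ ^ 2 = 2) (hram : 4 ∣ ∏ᶠ v : HeightOneSpectrum (𝓞 K), v.asIdeal.ramificationIdxIn (𝓞 L))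
    (hK : Odd (narrowClassNumber K)) :
    ¬ (∀ κ : ZpExtension K 2, κ.IsCyclotomic →
        ∀ [NumberField ↥(κ.layer 0)] [NumberField ↥(κ.layer 1)],
          (powMonoidHom (α := NarrowClassGroup ↥(κ.layer 1)) 2).range.index =
            (powMonoidHom (α := NarrowClassGroup ↥(κ.layer 0)) 2).range.index) := by
  haveI : Fact (Nat.Prime 2) := ⟨Nat.prime_two⟩
  intro h
  have hK2 : ¬ 2 ∣ Module.finrank ℚ K := hdeg.not_two_dvd_nat
  have hsurj := ZpExtension.surjective_comp_absGaloisRestrict_of_not_dvd_finrank (CyclotomicZp.zpExtension 2) K hK2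
  set κ : ZpExtension K 2 := (CyclotomicZp.zpExtension 2).restrict K hsurj with hκdef
  have hκ : κ.IsCyclotomic := ZpExtension.isCyclotomic_restrict _ (CyclotomicZp.isCyclotomic_zpExtension 2) K hsurj
  haveI : FiniteDimensional K ↥(κ.layer 0) := κ.finiteDimensional_layer_holds 0
  haveI : FiniteDimensional K ↥(κ.layer 1) := κ.finiteDimensional_layer_holds 1
  haveI : NumberField ↥(κ.layer 0) := NumberField.of_module_finite K _
  haveI : NumberField ↥(κ.layer 1) := NumberField.of_module_finite K _
  exact index_range_pow_two_narrowClassGroup_layer_one_ne_layer_zero hdeg κ hκ L hL θ hθ hram hK (h κ hκ)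

end Literature.NumberTheory.IwasawaTheory

end
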